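import Mathlib.Combinatorics.SimpleGraph.Connectivity.Connected
import Mathlib.Data.Set.Card
import Mathlib.Data.Fintype.Sum
import Mathlib.Algebra.BigOperators.Group.Finset.Basic
import HarnessLib

/-!
# The slice test (D) + (P) is exactly «every closed split is balanced» — RULE R′ in triangle language

Cell `pub-hsemireg`, widening group W5, seat w5-n7-1 (gen 11); files of record `widen/W5/N7-FEASIBILITY-w5n7.md`
(N7F) §3.9 (a) / TABLE-W5-N7 row N7-13 («SLICE TEST IN TRIANGLE LANGUAGE (exact reformulation of RULE R′ as implemented
from th-7's definition; PROVED, two lines)», tier ×1, read invited) and th-7's `theory/FORMULA-N-th7.md` §O.6 (G) (RULE R′: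
for a pair (a, b) and a slice with vertex sets A, B the kernel shear exists iff the slice graph has NO ISOLATED VERTEX and
every connected component K has the same ratio #A_K : #B_K — at equal margins #A = #B, iff every component is BALANCED).
HONEST FRAMING: pure finite graph theory. A slice graph is a bipartite relation `E : α → β → Prop` between two finite
vertex sets (the a- and b-neighbours of the slicing vertex; an edge means «the triangle is absent»). A CLOSED SPLIT is a
pair `(SA, SB)` of subsets such that every edge joins `SA` to `SB` or `SAᶜ` to `SBᶜ` (no edge crosses; equivalently
`SA ⊔ SB` is a union of connected components). The encoders of record (csk4sat / csknsat, every W5 SAT census) impose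
(D) «no isolated vertex on either side» and (P) «no closed split with all four parts non-empty and #SA ≠ #SB».
What is kernel-checked:

* `forall_closed_split_card_eq_iff` — for `#α = #β`: «EVERY closed split has #SA = #SB» ⟺ (D) ∧ (P). (The four
  degenerate splits that (P) does not test are balanced by (D): an empty part forces its partner part empty, a full part
  forces its partner full.)
* `forall_closed_split_card_eq_iff_components` — for a bipartite simple graph on `α ⊕ β`: «every closed split has
  #SA = #SB» ⟺ «every connected component has as many α-vertices as β-vertices» (R′'s balance clause), via «membership in
  a closed split is constant along walks».
* `complete_passes` — the COROLLARY (TRIANGLE-FREE LEMMA): a vertex in no triangle has a complete bipartite slice graph,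
  which passes (D) ∧ (P).
* `light_level`, `deuce_matching` (with `card_eq_one_of_two`) — the instances μ = 1 (the LIGHT-LEVEL LEMMA: a margin-1 vertex passes iff its unique
  slice pair is an edge, i.e. it lies in no triangle) and μ = 2 ((P) is vacuous; the test is (D) alone: every vertex keeps
  a non-triangle partner, i.e. the triangles at a deuce form a partial matching).

NOT formalised: RULE R′'s derivation from deformation theory (th-7 §O.6), the encoders, any design. Nothing here is a
statement about a variety, a sheaf or a Hodge class, and nothing here bears on HC / HC_CM / HC_AV.
-/

open Finset

namespace Summit.Ventures.HSemireg.SliceTestBalance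

variable {α β : Type*} [Fintype α] [Fintype β] [DecidableEq α] [DecidableEq β]

/-- **The slice test is exact.** For a bipartite relation `E` between finite sets of the same size: every CLOSED split
(`E a b → (a ∈ SA ↔ b ∈ SB)`) satisfies `#SA = #SB` if and only if (D) every vertex on either side has an `E`-neighbour
and (P) every closed split with all four parts `SA, SAᶜ, SB, SBᶜ` non-empty satisfies `#SA = #SB`. -/
theorem forall_closed_split_card_eq_iff (E : α → β → Prop) (hcard : Fintype.card α = Fintype.card β) :
    (∀ (SA : Finset α) (SB : Finset β), (∀ a b, E a b → (a ∈ SA ↔ b ∈ SB)) → SA.card = SB.card) ↔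
      ((∀ a, ∃ b, E a b) ∧ (∀ b, ∃ a, E a b)) ∧
        ∀ (SA : Finset α) (SB : Finset β), (∀ a b, E a b → (a ∈ SA ↔ b ∈ SB)) →
          SA.Nonempty → SAᶜ.Nonempty → SB.Nonempty → SBᶜ.Nonempty → SA.card = SB.card := by
  constructor
  · intro h
    refine ⟨⟨fun a => ?_, fun b => ?_⟩, fun SA SB hcl _ _ _ _ => h SA SB hcl⟩
    · -- an isolated α-vertex `a` gives the closed split ({a}, ∅) with 1 ≠ 0
      by_contra hiso
      push Not at hiso
      have h1 := h {a} ∅ (fun a' b hab => by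
        constructor
        · intro ha'
          rw [mem_singleton] at ha'
          exact absurd (ha' ▸ hab) (hiso b)
        · intro hb
          exact absurd hb (Finset.notMem_empty b))
      simp at h1
    · by_contra hiso
      push Not at hiso
      have h1 := h ∅ {b} (fun a b' hab => by
        constructor
        · intro ha
          exact absurd ha (Finset.notMem_empty a)
        · intro hb'
          rw [mem_singleton] at hb'
          exact absurd (hb' ▸ hab) (hiso a))
      simp at h1
  · rintro ⟨⟨hDa, hDb⟩, hP⟩ SA SB hcl
    by_cases hA : SA.Nonempty
    · by_cases hB : SB.Nonempty
      · by_cases hAc : SAᶜ.Nonempty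
        · by_cases hBc : SBᶜ.Nonempty
          · exact hP SA SB hcl hA hAc hB hBc
          · -- SB = univ forces SA = univ
            rw [not_nonempty_iff_eq_empty, compl_eq_empty_iff] at hBc
            have hAu : SA = univ := eq_univ_of_forall fun a => by
              obtain ⟨b, hab⟩ := hDa a
              exact (hcl a b hab).2 (hBc ▸ mem_univ b)
            rw [hAu, hBc, card_univ, card_univ, hcard]
        · -- SA = univ forces SB = univ
          rw [not_nonempty_iff_eq_empty, compl_eq_empty_iff] at hAc
          have hBu : SB = univ := eq_univ_of_forall fun b => by
            obtain ⟨a, hab⟩ := hDb b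
            exact (hcl a b hab).1 (hAc ▸ mem_univ a)
          rw [hAc, hBu, card_univ, card_univ, hcard]
      · -- SB = ∅ forces SA = ∅
        rw [not_nonempty_iff_eq_empty] at hB
        obtain ⟨a, ha⟩ := hA
        obtain ⟨b, hab⟩ := hDa a
        exact absurd ((hcl a b hab).1 ha) (hB ▸ Finset.notMem_empty b)
    · -- SA = ∅ forces SB = ∅
      rw [not_nonempty_iff_eq_empty] at hA
      have hB : SB = ∅ := by
        rw [← not_nonempty_iff_eq_empty]
        rintro ⟨b, hb⟩
        obtain ⟨a, hab⟩ := hDb b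
        exact absurd ((hcl a b hab).2 hb) (hA ▸ Finset.notMem_empty a)
      rw [hA, hB, card_empty, card_empty]

omit [Fintype α] [Fintype β] [DecidableEq α] [DecidableEq β] in
/-- Membership in a closed split is constant along the walks of a bipartite graph (no edge inside `α` or inside `β`). -/
theorem mem_iff_of_walk (G : SimpleGraph (α ⊕ β)) (hAA : ∀ a a' : α, ¬ G.Adj (.inl a) (.inl a'))
    (hBB : ∀ b b' : β, ¬ G.Adj (.inr b) (.inr b')) (SA : Finset α) (SB : Finset β)
    (hcl : ∀ a b, G.Adj (.inl a) (.inr b) → (a ∈ SA ↔ b ∈ SB)) :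
    ∀ {v w : α ⊕ β} (_ : G.Walk v w), (Sum.elim (· ∈ SA) (· ∈ SB) v ↔ Sum.elim (· ∈ SA) (· ∈ SB) w)
  | _, _, .nil => Iff.rfl
  | v, _, .cons (v := w') h p => by
    have hstep : (Sum.elim (· ∈ SA) (· ∈ SB) v ↔ Sum.elim (· ∈ SA) (· ∈ SB) w') := by
      cases v with
      | inl a =>
        cases w' with
        | inl a' => exact absurd h (hAA a a')
        | inr b => exact hcl a b h
      | inr b =>
        cases w' with
        | inl a => exact (hcl a b h.symm).symm
        | inr b' => exact absurd h (hBB b b')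
    exact hstep.trans (mem_iff_of_walk G hAA hBB SA SB hcl p)

omit [DecidableEq α] [DecidableEq β] in
/-- **Closed splits are balanced iff connected components are balanced** (R′'s balance clause). For a bipartite simple
graph on `α ⊕ β` (no edge inside `α` or inside `β`): every closed split has `#SA = #SB` iff every connected component
contains as many `α`-vertices as `β`-vertices. (A component is a closed split; a closed split is a union of components.) -/
theorem forall_closed_split_card_eq_iff_components (G : SimpleGraph (α ⊕ β))
    (hAA : ∀ a a' : α, ¬ G.Adj (.inl a) (.inl a')) (hBB : ∀ b b' : β, ¬ G.Adj (.inr b) (.inr b')) :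
    (∀ (SA : Finset α) (SB : Finset β), (∀ a b, G.Adj (.inl a) (.inr b) → (a ∈ SA ↔ b ∈ SB)) → SA.card = SB.card) ↔
      ∀ K : G.ConnectedComponent,
        {a : α | G.connectedComponentMk (.inl a) = K}.ncard = {b : β | G.connectedComponentMk (.inr b) = K}.ncard := by
  classical
  haveI : Fintype G.ConnectedComponent := Fintype.ofFinite _
  constructor
  · intro h K
    -- the component K is a closed split
    have hcl : ∀ a b, G.Adj (.inl a) (.inr b) →
        (a ∈ univ.filter (fun a => G.connectedComponentMk (.inl a) = K) ↔
          b ∈ univ.filter (fun b => G.connectedComponentMk (.inr b) = K)) := by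
      intro a b hab
      simp only [mem_filter, mem_univ, true_and]
      rw [SimpleGraph.ConnectedComponent.connectedComponentMk_eq_of_adj hab]
    have hK := h _ _ hcl
    have eA : {a : α | G.connectedComponentMk (.inl a) = K} =
        ↑(univ.filter (fun a => G.connectedComponentMk (.inl a) = K)) := by
      ext a; simp
    have eB : {b : β | G.connectedComponentMk (.inr b) = K} =
        ↑(univ.filter (fun b => G.connectedComponentMk (.inr b) = K)) := by
      ext b; simp
    rw [eA, eB, Set.ncard_coe_finset, Set.ncard_coe_finset, hK]
  · intro hK SA SB hcl
    -- count both sides fiberwise over the components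
    have hfibA := card_eq_sum_card_fiberwise (f := fun a : α => G.connectedComponentMk (.inl a)) (s := SA)
      (t := univ) (fun a _ => mem_univ _)
    have hfibB := card_eq_sum_card_fiberwise (f := fun b : β => G.connectedComponentMk (.inr b)) (s := SB)
      (t := univ) (fun b _ => mem_univ _)
    rw [hfibA, hfibB]
    refine sum_congr rfl fun K _ => ?_
    -- in the component of `v₀`, membership in the split is the constant `Sum.elim (· ∈ SA) (· ∈ SB) v₀`
    induction K using SimpleGraph.ConnectedComponent.ind with
    | h v₀ =>
      have hconst : ∀ v, G.connectedComponentMk v = G.connectedComponentMk v₀ →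
          (Sum.elim (· ∈ SA) (· ∈ SB) v ↔ Sum.elim (· ∈ SA) (· ∈ SB) v₀) := fun v hv =>
        (SimpleGraph.ConnectedComponent.exact hv).elim fun p => mem_iff_of_walk G hAA hBB SA SB hcl p
      have hKab : #(univ.filter fun a : α => G.connectedComponentMk (.inl a) = G.connectedComponentMk v₀) =
          #(univ.filter fun b : β => G.connectedComponentMk (.inr b) = G.connectedComponentMk v₀) := by
        have := hK (G.connectedComponentMk v₀)
        have eA : {a : α | G.connectedComponentMk (.inl a) = G.connectedComponentMk v₀} =
            ↑(univ.filter fun a : α => G.connectedComponentMk (.inl a) = G.connectedComponentMk v₀) := by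
          ext a; simp
        have eB : {b : β | G.connectedComponentMk (.inr b) = G.connectedComponentMk v₀} =
            ↑(univ.filter fun b : β => G.connectedComponentMk (.inr b) = G.connectedComponentMk v₀) := by
          ext b; simp
        rwa [eA, eB, Set.ncard_coe_finset, Set.ncard_coe_finset] at this
      by_cases h0 : Sum.elim (· ∈ SA) (· ∈ SB) v₀
      · -- the whole component lies inside the split
        have eA : SA.filter (fun a => G.connectedComponentMk (.inl a) = G.connectedComponentMk v₀) =
            univ.filter (fun a : α => G.connectedComponentMk (.inl a) = G.connectedComponentMk v₀) := by
          ext a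
          simp only [mem_filter, mem_univ, true_and, and_iff_right_iff_imp]
          intro ha
          exact (hconst (.inl a) ha).2 h0
        have eB : SB.filter (fun b => G.connectedComponentMk (.inr b) = G.connectedComponentMk v₀) =
            univ.filter (fun b : β => G.connectedComponentMk (.inr b) = G.connectedComponentMk v₀) := by
          ext b
          simp only [mem_filter, mem_univ, true_and, and_iff_right_iff_imp]
          intro hb
          exact (hconst (.inr b) hb).2 h0
        rw [eA, eB, hKab]
      · -- the whole component lies outside the split
        have eA : SA.filter (fun a => G.connectedComponentMk (.inl a) = G.connectedComponentMk v₀) = ∅ := by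
          rw [Finset.filter_eq_empty_iff]
          intro a ha hK'
          exact h0 ((hconst (.inl a) hK').1 ha)
        have eB : SB.filter (fun b => G.connectedComponentMk (.inr b) = G.connectedComponentMk v₀) = ∅ := by
          rw [Finset.filter_eq_empty_iff]
          intro b hb hK'
          exact h0 ((hconst (.inr b) hK').1 hb)
        rw [eA, eB, card_empty, card_empty]

/-- **μ = 1: the LIGHT-LEVEL LEMMA.** If both sides are singletons, the slice test (D) ∧ (P) holds iff the unique pair is
an edge (the slicing vertex lies in NO triangle); (P) is vacuous. -/
theorem light_level (E : α → β → Prop) (a₀ : α) (b₀ : β) (hα : ∀ a, a = a₀) (hβ : ∀ b, b = b₀) :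
    (((∀ a, ∃ b, E a b) ∧ (∀ b, ∃ a, E a b)) ∧
        ∀ (SA : Finset α) (SB : Finset β), (∀ a b, E a b → (a ∈ SA ↔ b ∈ SB)) →
          SA.Nonempty → SAᶜ.Nonempty → SB.Nonempty → SBᶜ.Nonempty → SA.card = SB.card) ↔ E a₀ b₀ := by
  constructor
  · rintro ⟨⟨hDa, -⟩, -⟩
    obtain ⟨b, hb⟩ := hDa a₀
    rwa [hβ b] at hb
  · intro h
    refine ⟨⟨fun a => ⟨b₀, (hα a) ▸ h⟩, fun b => ⟨a₀, (hβ b) ▸ h⟩⟩, ?_⟩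
    intro SA SB _ hA hAc _ _
    -- a singleton side has no split with both parts non-empty
    obtain ⟨a, ha⟩ := hA
    obtain ⟨a', ha'⟩ := hAc
    rw [hα a] at ha
    rw [hα a', mem_compl] at ha'
    exact absurd ha ha'

/-- A non-empty subset of a 2-element type with non-empty complement has exactly one element. -/
theorem card_eq_one_of_two {γ : Type*} [Fintype γ] [DecidableEq γ] (S : Finset γ) (hγ : Fintype.card γ = 2)
    (hS : S.Nonempty) (hSc : Sᶜ.Nonempty) : S.card = 1 := by
  have hlt : S.card < 2 := by
    rw [← hγ, ← card_univ]
    exact card_lt_card ⟨subset_univ S, fun hsub => by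
      obtain ⟨x, hx⟩ := hSc
      exact (mem_compl.1 hx) (hsub (mem_univ x))⟩
  have hpos : 0 < S.card := card_pos.2 hS
  omega

/-- **μ = 2: the DEUCE SLICE.** If both sides have exactly two elements, (P) is vacuous (a closed split with all four
parts non-empty has #SA = #SB = 1), so the slice test is (D) alone: every vertex keeps an `E`-partner — in triangle
language, the triangles at a margin-2 vertex form a partial matching of its two neighbour pairs. -/
theorem deuce_matching (E : α → β → Prop) (hα : Fintype.card α = 2) (hβ : Fintype.card β = 2) :
    (((∀ a, ∃ b, E a b) ∧ (∀ b, ∃ a, E a b)) ∧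
        ∀ (SA : Finset α) (SB : Finset β), (∀ a b, E a b → (a ∈ SA ↔ b ∈ SB)) →
          SA.Nonempty → SAᶜ.Nonempty → SB.Nonempty → SBᶜ.Nonempty → SA.card = SB.card) ↔
      ((∀ a, ∃ b, E a b) ∧ (∀ b, ∃ a, E a b)) := by
  refine ⟨fun h => h.1, fun hD => ⟨hD, ?_⟩⟩
  intro SA SB _ hA hAc hB hBc
  rw [card_eq_one_of_two SA hα hA hAc, card_eq_one_of_two SB hβ hB hBc]

/-- **COROLLARY (TRIANGLE-FREE LEMMA), N7F §3.9 (a).** If the slicing vertex lies in no triangle at all, its slice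
graph is complete bipartite (`E a b` for all `a, b`), and then — both sides being non-empty — the slice test (D) ∧ (P)
holds: a margin-uniform design WITHOUT triangles passes the test at every slice of every pair. -/
theorem complete_passes (E : α → β → Prop) (hE : ∀ a b, E a b) [Nonempty α] [Nonempty β] :
    ((∀ a, ∃ b, E a b) ∧ (∀ b, ∃ a, E a b)) ∧
      ∀ (SA : Finset α) (SB : Finset β), (∀ a b, E a b → (a ∈ SA ↔ b ∈ SB)) →
        SA.Nonempty → SAᶜ.Nonempty → SB.Nonempty → SBᶜ.Nonempty → SA.card = SB.card := by
  refine ⟨⟨fun a => ⟨Classical.arbitrary β, hE a _⟩, fun b => ⟨Classical.arbitrary α, hE _ b⟩⟩, ?_⟩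
  intro SA SB hcl hA _ _ hBc
  -- an element of SA and an element outside SB are joined by an edge: the split is not closed
  obtain ⟨a, ha⟩ := hA
  obtain ⟨b, hb⟩ := hBc
  exact absurd ((hcl a b (hE a b)).1 ha) (mem_compl.1 hb)

end Summit.Ventures.HSemireg.SliceTestBalance
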